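import Literature.Computability.Complexity.LundYannakakisTheorem
import Literature.Computability.Complexity.SatUnsatPromiseHard
import Literature.Computability.Complexity.E3InstanceMachine
import Literature.Computability.Complexity.ApproximationProofs
import HarnessLib

/-!
# Gap set cover, II: `AroraEtAl1997_prop6` reduced to the NP-hardness of gap label cover

Topic `Computability/Complexity`, namespace `Literature.Computability.Complexity`. The glue of
the Lund–Yannakakis route to the named fact `AroraEtAl1997_prop6` of `GapSetCover.lean`
(Arora–Babai–Stern–Sweedyk 1997, Prop. 6: for every `c > 1`, `(SAT, UNSAT)` Karp-reduces to gap
exact set cover `gapSetCover c`), everything PROVED: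

* `isNPHard_gapSetCover_of_gapLabelCover` — NP-hardness moves along the DISCHARGED reduction
  `AroraBarak2009_thm2231_holds` (`LundYannakakisTheorem.lean`; Arora–Barak 2009, Thm. 22.31):
  if `gapLabelCover W ε` is NP-hard, `0 < ε`, `0 < c` and `16 c² ε ≤ 1`, then `gapSetCover c`
  is NP-hard;
* `satUnsatPromise_polyTimeReducible_of_isNPHard`, `isNPHard_of_satUnsatPromise_polyTimeReducible`,
  `AroraEtAl1997_prop6_iff_isNPHard_gapSetCover` — the printed form "given an instance `φ` of
  SAT …" (a Karp reduction from `satUnsatPromise`) is equivalent to NP-hardness of the promise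
  problem (`PromiseProblem.IsNPHard`), by `SAT ∈ NP` (`SAT_mem_NP_holds`) one way and the
  NP-hardness of `(SAT, UNSAT)` (`satUnsatPromise_isNPHard`) the other;
* `AroraEtAl1997_prop6_of_isNPHard_gapLabelCover` — **Prop. 6 follows from the NP-hardness of
  gap label cover for every constant soundness error** (`∀ ε > 0, ∃ W, gapLabelCover W ε` is
  NP-hard): take `ε = 1 / (16 c²)`;
* `AroraEtAl1997_prop6_of_raz` — **Prop. 6 follows from Raz's theorem in the form of
  Arora–Barak 2009, Thm. 22.15** ("There is a `c > 1` such that for every `t > 1`,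
  `GAP 2CSP_W(ε)` is NP-hard for `ε = 2^{-t}`, `W = 2^{ct}`, and this is true also for 2CSP
  instances that are regular and have the projection property", p. 473), rendered exactly as
  the hypothesis `∃ c : ℕ, 1 < c ∧ ∀ t : ℕ, 1 < t → (gapLabelCover (2 ^ (c * t)) (1 / 2 ^ t)).IsNPHard`.

## Why the hypothesis is not a named fact (D-0026)

Thm. 22.15 rests on the PCP theorem and on Raz's parallel repetition theorem (Raz 1998,
Thm. 1.1), neither of which is proved in the tree (Arora–Barak do not prove it either: §22.3.1
only sketches the idea; the tree's equality `pcp_theorem` of `Approximation.lean` is moreover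
refuted as stated, `pcp_theorem_false` in `PCPSubsetNP.lean`). It is therefore of the same
depth as `AroraEtAl1997_prop6` itself (ABSS 1997 attribute Prop. 6 to Bellare–Goldwasser–Lund–
Russell 1993, a PCP construction), not an M-sized step towards it, and it is NOT kept as a
second unproved named fact next to `AroraEtAl1997_prop6`: the cone (Khot 2005, Thm. 3.1,
`Literature/Algebra/EuclideanLattices/KhotNPHardness.lean`) keeps the single PCP-level
hypothesis `AroraEtAl1997_prop6`, and this file records, with proof, exactly what is left
between it and the discharged combinatorics: the NP-hardness of `gapLabelCover`.

## References

* S. Arora, L. Babai, J. Stern, Z. Sweedyk, *The hardness of approximate optima in lattices,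
  codes, and systems of linear equations*, J. Comput. Syst. Sci. 54 (1997) 317–331, Prop. 6
  (p. 319).
* S. Arora, B. Barak, *Computational Complexity: A Modern Approach*, CUP 2009, Thm. 22.15
  (p. 473), §22.3.1, Thm. 22.31 and its proof (§22.8).
* R. Raz, *A parallel repetition theorem*, SIAM J. Comput. 27 (1998) 763–803, Thm. 1.1.
* O. Goldreich, *On promise problems: a survey*, LNCS 3895 (2006), §1.1 and Def. 1.4.
-/

namespace Literature.Computability.Complexity

open PromiseProblem

/-! ### NP-hardness along the Lund–Yannakakis reduction -/

/-- **NP-hardness of gap label cover transfers to gap set cover** along the discharged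
Lund–Yannakakis reduction (`AroraBarak2009_thm2231_holds`): if `gapLabelCover W ε` is NP-hard,
`0 < ε`, `0 < c` and `16 c² ε ≤ 1`, then `gapSetCover c` is NP-hard.
[cite: AroraBarak2009, Thm. 22.31 (§22.8)] -/
theorem isNPHard_gapSetCover_of_gapLabelCover {W : ℕ} {ε : ℝ} {c : ℚ}
    (h : (gapLabelCover W ε).IsNPHard) (hε : 0 < ε) (hc : 0 < c)
    (h16 : (c : ℝ) ^ 2 * ε * 16 ≤ 1) : (gapSetCover c).IsNPHard :=
  PromiseProblem.IsHard.of_reducible_holds h (AroraBarak2009_thm2231_holds W ε c hε hc h16)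

/-! ### The printed form of Prop. 6 versus NP-hardness of the promise problem -/

/-- An NP-hard promise problem `Q` receives a Karp reduction from `(SAT, UNSAT)`: apply the
hardness to `SAT ∈ NP` (`SAT_mem_NP_holds`) and precompose with the identity reduction
`(SAT, UNSAT) → ofLanguage SAT`. [cite: Goldreich2006, §1.1 and Def. 1.4] -/
theorem satUnsatPromise_polyTimeReducible_of_isNPHard {Q : PromiseProblem} (h : Q.IsNPHard) :
    satUnsatPromise.PolyTimeReducible Q :=
  polyTimeReducible_satUnsatPromise_of_ofLanguage_SAT (h SAT SAT_mem_NP_holds)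

/-- Conversely, a promise problem receiving a Karp reduction from `(SAT, UNSAT)` is NP-hard,
`(SAT, UNSAT)` being NP-hard (`satUnsatPromise_isNPHard`, Cook–Levin).
[cite: Goldreich2006, §1.1 and Def. 1.4] -/
theorem isNPHard_of_satUnsatPromise_polyTimeReducible {Q : PromiseProblem}
    (h : satUnsatPromise.PolyTimeReducible Q) : Q.IsNPHard :=
  PromiseProblem.IsHard.of_reducible_holds satUnsatPromise_isNPHard h

/-- **ABSS 1997, Prop. 6 is the NP-hardness of `gapSetCover c` for every `c > 1`** (as a
promise problem, `PromiseProblem.IsNPHard`). [cite: AroraEtAl1997, Prop. 6 (p. 319)] -/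
theorem AroraEtAl1997_prop6_iff_isNPHard_gapSetCover :
    AroraEtAl1997_prop6 ↔ ∀ c : ℚ, 1 < c → (gapSetCover c).IsNPHard :=
  ⟨fun h c hc => isNPHard_of_satUnsatPromise_polyTimeReducible (h c hc),
    fun h c hc => satUnsatPromise_polyTimeReducible_of_isNPHard (h c hc)⟩

/-- Under `AroraEtAl1997_prop6`, `gapSetCover c` is NP-hard for every `c > 1`.
[cite: AroraEtAl1997, Prop. 6 (p. 319)] -/
theorem AroraEtAl1997_prop6.isNPHard_gapSetCover (h : AroraEtAl1997_prop6) {c : ℚ}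
    (hc : 1 < c) : (gapSetCover c).IsNPHard :=
  AroraEtAl1997_prop6_iff_isNPHard_gapSetCover.1 h c hc

/-! ### Prop. 6 from the NP-hardness of gap label cover -/

/-- **ABSS 1997, Prop. 6 from the NP-hardness of gap label cover for every constant soundness
error**: if for every `ε > 0` some `gapLabelCover W ε` (regular projection instances over `[W]`,
YES `val = 1`, NO `val < ε`) is NP-hard, then for every `c > 1` the promise problem
`(SAT, UNSAT)` Karp-reduces to `gapSetCover c` — through the Lund–Yannakakis reduction with
`ε = 1 / (16 c²)` (Arora–Barak 2009, proof of Thm. 22.31: `T = 1/(4√ε)`).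
[cite: AroraBarak2009, Thm. 22.31 (§22.8)] -/
theorem AroraEtAl1997_prop6_of_isNPHard_gapLabelCover
    (h : ∀ ε : ℝ, 0 < ε → ∃ W : ℕ, (gapLabelCover W ε).IsNPHard) : AroraEtAl1997_prop6 := by
  intro c hc
  have hc0 : (0 : ℚ) < c := one_pos.trans hc
  have hc16 : (0 : ℝ) < (c : ℝ) ^ 2 * 16 := by positivity
  obtain ⟨W, hW⟩ := h (1 / ((c : ℝ) ^ 2 * 16)) (by positivity)
  refine satUnsatPromise_polyTimeReducible_of_isNPHard
    (isNPHard_gapSetCover_of_gapLabelCover hW (by positivity) hc0 (le_of_eq ?_))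
  field_simp

/-- **ABSS 1997, Prop. 6 from Raz's theorem in the form of Arora–Barak 2009, Thm. 22.15.**
Printed (p. 473): "There is a `c > 1` such that for every `t > 1`, `GAP 2CSP_W(ε)` is NP-hard
for `ε = 2^{-t}`, `W = 2^{ct}`, and this is true also for 2CSP instances that are regular and
have the projection property" — the hypothesis, with `c t : ℕ` and NP-hardness of the promise
problem `gapLabelCover (2 ^ (c * t)) (1 / 2 ^ t)` on regular projection instances (Def. 11.13:
`x ∈ L ⇒ val = 1`, `x ∉ L ⇒ val < ε`). It is a consequence of the PCP theorem and Raz's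
parallel repetition theorem (Raz 1998, Thm. 1.1), not proved in the tree and deliberately not a
named fact (module docstring); given it, every constant soundness error `ε > 0` is reached with
`2^{-t} ≤ ε` (`PromiseProblem.PolyTimeReducible.gapLabelCover_mono`) and
`AroraEtAl1997_prop6_of_isNPHard_gapLabelCover` applies.
[cite: AroraBarak2009, Thm. 22.15 (p. 473) and Thm. 22.31 (§22.8)] -/
theorem AroraEtAl1997_prop6_of_raz
    (h : ∃ c : ℕ, 1 < c ∧ ∀ t : ℕ, 1 < t → (gapLabelCover (2 ^ (c * t)) (1 / 2 ^ t)).IsNPHard) :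
    AroraEtAl1997_prop6 := by
  refine AroraEtAl1997_prop6_of_isNPHard_gapLabelCover fun ε hε => ?_
  obtain ⟨c, -, hct⟩ := h
  obtain ⟨t, ht1, htε⟩ : ∃ t : ℕ, 1 < t ∧ (1 : ℝ) / 2 ^ t ≤ ε := by
    obtain ⟨n, hn⟩ := exists_pow_lt_of_lt_one hε (by norm_num : (1 / 2 : ℝ) < 1)
    refine ⟨n + 2, by omega, le_trans ?_ hn.le⟩
    rw [div_pow, one_pow]
    gcongr
    · norm_num
    · omega
  exact ⟨2 ^ (c * t), fun L hL => (hct t ht1 L hL).gapLabelCover_mono htε⟩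

/-! ### The discharge (appended 2026-08-15)

Since the sections above were written, both inputs of `AroraEtAl1997_prop6_of_isNPHard_gapLabelCover`
have landed in the tree: the PCP theorem in gap form — Dinur's gap amplification on the Gabber–Galil
kit gives the gap machine `GapPV.ggMachine : GapMachine (GapPV.ε₁Q ggP)` (`ApproximationProofs.lean`,
the cone of `pcp_theorem_exact_holds`), whence `gapE3SAT (1/8 - ε₁)` is NP-hard
(`gapE3SAT_isNPHard_of_gapMachine`, `GapAssembly.lean`) — and the soundness amplification for label
cover from gap-E3SAT hardness alone (`Expander.E3LC.isNPHard_gapLabelCover_forall_of_gapE3SAT_hard`,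
`E3InstanceMachine.lean`, Arora–Barak Thm. 22.15 in the tree's form via Dinur–Steurer). Composing them
discharges the named fact; the module docstring's "neither of which is proved in the tree" is
superseded by this section. -/

/-- **Arora–Babai–Stern–Sweedyk 1997, Prop. 6, PROVED** (discharge of the named fact
`AroraEtAl1997_prop6` of `GapSetCover.lean`): for every rational `c > 1`, (SAT, UNSAT) Karp-reduces
to gap exact set cover `gapSetCover c`. Proof: the PCP theorem in gap form (Dinur; the gap machine
`GapPV.ggMachine`, `gapE3SAT_isNPHard_of_gapMachine`), label cover with every constant soundness error
(`Expander.E3LC.isNPHard_gapLabelCover_forall_of_gapE3SAT_hard`), then Lund–Yannakakis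
(`AroraEtAl1997_prop6_of_isNPHard_gapLabelCover`). [cite: AroraEtAl1997, Prop. 6 (p. 319)] -/
theorem AroraEtAl1997_prop6_holds : AroraEtAl1997_prop6 :=
  AroraEtAl1997_prop6_of_isNPHard_gapLabelCover
    (Expander.E3LC.isNPHard_gapLabelCover_forall_of_gapE3SAT_hard (GapPV.ε₁Q_pos _) (GapPV.ε₁Q_le _)
      (gapE3SAT_isNPHard_of_gapMachine GapPV.ggMachine (GapPV.ε₁Q_le _)))

/-- **Gap exact set cover is NP-hard for every constant factor `c > 1`**, unconditionally
(`AroraEtAl1997_prop6_holds` through `AroraEtAl1997_prop6_iff_isNPHard_gapSetCover`).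
[cite: AroraEtAl1997, Prop. 6 (p. 319)] -/
theorem isNPHard_gapSetCover {c : ℚ} (hc : 1 < c) : (gapSetCover c).IsNPHard :=
  AroraEtAl1997_prop6_holds.isNPHard_gapSetCover hc

end Literature.Computability.Complexity
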